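import Mathlib
import HarnessLib

/-!
# Primitive rules for the infinite interval (Davis–Rabinowitz 1984, Sect. 3.4)

Davis–Rabinowitz, *Methods of Numerical Integration* (2nd ed., 1984), Sect. 3.4, pp. 203–204: the right-hand
Riemann sum `R_R(f; h) = h Σ_{k ≥ 1} f(kh)` (3.4.1), the left-hand sum `R_L = h f(0) + R_R` and the trapezoidal
rule `T = ½ h f(0) + R_R` for `∫_0^∞ f`, and the book's THEOREM for monotonic integrands:

* `summable_comp_succ_mul`: for `f ≥ 0` decreasing with `∫_0^∞ f < ∞` the sum `Σ f(kh)` converges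
  (Mathlib's integral test `AntitoneOn.summable_of_integrableOn_Ioi_zero`, rescaled by `h`);
* **(3.4.4)** `integral_Ioi_le_rightRiemannSumIoi`, `rightRiemannSumIoi_le_integral`:
  `∫_h^∞ f ≤ h Σ_{k ≥ 1} f(kh) ≤ ∫_0^∞ f` (the `n → ∞` limit of the sandwich (3.4.3); Mathlib's
  unit-step `AntitoneOn.integral_le_tsum_comp_add` / `tsum_add_one_le_integral`, rescaled);
* **(3.4.5)** `integral_sub_rightRiemannSumIoi_mem_Icc` (and the three separate inequalities):
  `0 ≤ ∫_0^∞ f - R_R(f; h) ≤ ∫_0^h f ≤ h f(0)` — "an indication of very slow convergence in general";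
  the left-sum version `integral_sub_leftRiemannSumIoi_mem_Icc`;
* **Theorem (3.4.2)** `tendsto_rightRiemannSumIoi`, `tendsto_leftRiemannSumIoi` (and `tendsto_trapezoidalSumIoi`):
  `lim_{h → 0+} R_L(f; h) = lim_{h → 0+} R_R(f; h) = ∫_0^∞ f`.

The book states the theorem for `f` monotonic with `∫_0^∞ f` existing and reduces to the case `f` positive and
decreasing ("without loss of generality"); that case is the one recorded, with the hypotheses
`AntitoneOn f (Ici 0)`, `IntegrableOn f (Ioi 0)`, `0 ≤ f` on `(0, ∞)` exactly as in Mathlib's integral test.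

Provenance: engines group, shared numerical engines serving client cells; rigour lives in the verifiers; every
published number belongs to a client cell's ledger, not to the engines group.  This file records textbook
facts only (no client numbers).
-/

namespace Literature.Analysis.Quadrature

open Set MeasureTheory Filter Topology
open scoped Real

noncomputable section

/-- The right-hand Riemann sum on `[0, ∞)` (3.4.1): `R_R(f; h) = h[f(h) + f(2h) + ⋯] = h Σ_{k ≥ 1} f(kh)`.
[cite: DavisRabinowitz1984, Sect. 3.4 (3.4.1)] -/
def rightRiemannSumIoi (f : ℝ → ℝ) (h : ℝ) : ℝ := h * ∑' k : ℕ, f (((k : ℝ) + 1) * h)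

/-- The left-hand Riemann sum on `[0, ∞)`: `R_L(f; h) = h f(0) + R_R(f; h)`.
[cite: DavisRabinowitz1984, Sect. 3.4 (3.4.1)] -/
def leftRiemannSumIoi (f : ℝ → ℝ) (h : ℝ) : ℝ := h * f 0 + rightRiemannSumIoi f h

/-- The trapezoidal rule on `[0, ∞)`, the average of the two: `T(f; h) = ½ h f(0) + R_R(f; h) = h Σ'' f(kh)`.
[cite: DavisRabinowitz1984, Sect. 3.4 (3.4.1)] -/
def trapezoidalSumIoi (f : ℝ → ℝ) (h : ℝ) : ℝ := h / 2 * f 0 + rightRiemannSumIoi f h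

/-- `T = ½ (R_L + R_R)`. [cite: DavisRabinowitz1984, Sect. 3.4 (3.4.1)] -/
theorem trapezoidalSumIoi_eq_add_div_two (f : ℝ → ℝ) (h : ℝ) :
    trapezoidalSumIoi f h = (leftRiemannSumIoi f h + rightRiemannSumIoi f h) / 2 := by
  unfold trapezoidalSumIoi leftRiemannSumIoi
  ring

section scaling

variable {f : ℝ → ℝ} {h : ℝ}

/-- [folklore] the rescaled integrand `u ↦ f(hu)` is antitone on `[0, ∞)`. -/
private theorem antitoneOn_comp_mul (anti : AntitoneOn f (Ici 0)) (hh : 0 < h) :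
    AntitoneOn (fun u => f (h * u)) (Ici 0) := fun _ hu _ hv huv =>
  anti (mem_Ici.2 (mul_nonneg hh.le hu)) (mem_Ici.2 (mul_nonneg hh.le hv)) (mul_le_mul_of_nonneg_left huv hh.le)

/-- [folklore] `∫_{c}^{∞} f(hu) du = h⁻¹ ∫_{hc}^{∞} f`. -/
private theorem integral_Ioi_comp_mul (f : ℝ → ℝ) (c : ℝ) (hh : 0 < h) :
    ∫ u in Ioi c, f (h * u) = h⁻¹ * ∫ x in Ioi (h * c), f x := by
  rw [integral_comp_mul_left_Ioi f c hh, smul_eq_mul]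

end scaling

variable {f : ℝ → ℝ} {h : ℝ}

/-- For `f` non-negative and decreasing on `[0, ∞)` with `∫_0^∞ f` existing, the Riemann sums `Σ_k f(kh)`
converge (integral test, rescaled); in particular `R_R(f; h)` is a genuine sum.
[cite: DavisRabinowitz1984, Sect. 3.4 (3.4.4)] -/
theorem summable_comp_succ_mul (anti : AntitoneOn f (Ici 0)) (hint : IntegrableOn f (Ioi 0))
    (nonneg : ∀ t ∈ Ioi (0 : ℝ), 0 ≤ f t) (hh : 0 < h) : Summable fun k : ℕ => f (((k : ℝ) + 1) * h) := by
  have hg : Summable fun k : ℕ => f (h * k) :=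
    (antitoneOn_comp_mul anti hh).summable_of_integrableOn_Ioi_zero
      ((integrableOn_Ioi_comp_mul_left_iff f 0 hh).2 (by simpa using hint))
      fun t ht => nonneg _ (mem_Ioi.2 (mul_pos hh ht))
  have h1 := (summable_nat_add_iff 1).2 hg
  refine h1.congr fun k => ?_
  simp only [Nat.cast_add, Nat.cast_one]
  ring_nf

/-- **(3.4.4)**: `∫_h^∞ f ≤ h Σ_{k ≥ 1} f(kh) ≤ ∫_0^∞ f` for `f` non-negative and decreasing with
`∫_0^∞ f < ∞` (from (3.4.3) letting `n → ∞`) — right inequality.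
[cite: DavisRabinowitz1984, Sect. 3.4 (3.4.4)] -/
theorem rightRiemannSumIoi_le_integral (anti : AntitoneOn f (Ici 0)) (hint : IntegrableOn f (Ioi 0))
    (nonneg : ∀ t ∈ Ioi (0 : ℝ), 0 ≤ f t) (hh : 0 < h) : rightRiemannSumIoi f h ≤ ∫ x in Ioi 0, f x := by
  have antig := antitoneOn_comp_mul anti hh
  have hintg : IntegrableOn (fun u => f (h * u)) (Ioi 0) :=
    (integrableOn_Ioi_comp_mul_left_iff f 0 hh).2 (by simpa using hint)
  have nonnegg : ∀ t ∈ Ioi (0 : ℝ), 0 ≤ f (h * t) := fun t ht => nonneg _ (mem_Ioi.2 (mul_pos hh ht))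
  have key := antig.tsum_add_one_le_integral hintg nonnegg
  rw [integral_Ioi_comp_mul f 0 hh, mul_zero] at key
  have hsum : ∑' k : ℕ, f (((k : ℝ) + 1) * h) = ∑' k : ℕ, f (h * ((k + 1 : ℕ) : ℝ)) :=
    tsum_congr fun k => by push_cast; ring_nf
  unfold rightRiemannSumIoi
  rw [hsum]
  calc h * ∑' k : ℕ, f (h * ((k + 1 : ℕ) : ℝ)) ≤ h * (h⁻¹ * ∫ x in Ioi 0, f x) :=
        mul_le_mul_of_nonneg_left key hh.le
    _ = ∫ x in Ioi 0, f x := by field_simp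

/-- **(3.4.4)**, left inequality: `∫_h^∞ f ≤ h Σ_{k ≥ 1} f(kh)`.
[cite: DavisRabinowitz1984, Sect. 3.4 (3.4.4)] -/
theorem integral_Ioi_le_rightRiemannSumIoi (anti : AntitoneOn f (Ici 0)) (hint : IntegrableOn f (Ioi 0))
    (nonneg : ∀ t ∈ Ioi (0 : ℝ), 0 ≤ f t) (hh : 0 < h) : ∫ x in Ioi h, f x ≤ rightRiemannSumIoi f h := by
  have antig := antitoneOn_comp_mul anti hh
  have hintg : IntegrableOn (fun u => f (h * u)) (Ioi 0) :=
    (integrableOn_Ioi_comp_mul_left_iff f 0 hh).2 (by simpa using hint)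
  have nonnegg : ∀ t ∈ Ioi (0 : ℝ), 0 ≤ f (h * t) := fun t ht => nonneg _ (mem_Ioi.2 (mul_pos hh ht))
  have hsg : Summable fun k : ℕ => f (h * k) := antig.summable_of_integrableOn_Ioi_zero hintg nonnegg
  have key := AntitoneOn.integral_le_tsum_comp_add (f := fun u => f (h * u)) 1
    (antig.mono (Ici_subset_Ici.2 (by norm_num))) hsg (fun t ht => nonnegg t (mem_Ioi.2 (by
      have := mem_Ioi.1 ht; push_cast at this; linarith)))
  push_cast at key
  rw [integral_Ioi_comp_mul f 1 hh, mul_one] at key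
  have hsum : ∑' k : ℕ, f (((k : ℝ) + 1) * h) = ∑' k : ℕ, f (h * ((k : ℝ) + 1)) :=
    tsum_congr fun k => by ring_nf
  unfold rightRiemannSumIoi
  rw [hsum]
  calc ∫ x in Ioi h, f x = h * (h⁻¹ * ∫ x in Ioi h, f x) := by field_simp
    _ ≤ h * ∑' k : ℕ, f (h * ((k : ℝ) + 1)) := mul_le_mul_of_nonneg_left key hh.le

/-- [folklore] `∫_0^∞ f = ∫_0^h f + ∫_h^∞ f`. -/
private theorem integral_Ioi_eq_intervalIntegral_add (hint : IntegrableOn f (Ioi 0)) (hh : 0 ≤ h) :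
    ∫ x in Ioi 0, f x = (∫ x in (0 : ℝ)..h, f x) + ∫ x in Ioi h, f x := by
  rw [← Ioc_union_Ioi_eq_Ioi hh, setIntegral_union (Ioc_disjoint_Ioi le_rfl) measurableSet_Ioi
    (hint.mono_set Ioc_subset_Ioi_self) (hint.mono_set (Ioi_subset_Ioi hh)), intervalIntegral.integral_of_le hh]

/-- **Error estimate (3.4.5)**: `0 ≤ ∫_0^∞ f - h Σ_{k ≥ 1} f(kh) ≤ ∫_0^h f ≤ h f(0)` — "an indication of
very slow convergence in general".  Stated as the three inequalities.
[cite: DavisRabinowitz1984, Sect. 3.4 (3.4.5)] -/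
theorem integral_sub_rightRiemannSumIoi_nonneg (anti : AntitoneOn f (Ici 0)) (hint : IntegrableOn f (Ioi 0))
    (nonneg : ∀ t ∈ Ioi (0 : ℝ), 0 ≤ f t) (hh : 0 < h) :
    0 ≤ (∫ x in Ioi 0, f x) - rightRiemannSumIoi f h :=
  sub_nonneg.2 (rightRiemannSumIoi_le_integral anti hint nonneg hh)

/-- (3.4.5), middle inequality: `∫_0^∞ f - R_R(f; h) ≤ ∫_0^h f`.
[cite: DavisRabinowitz1984, Sect. 3.4 (3.4.5)] -/
theorem integral_sub_rightRiemannSumIoi_le_integral (anti : AntitoneOn f (Ici 0)) (hint : IntegrableOn f (Ioi 0))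
    (nonneg : ∀ t ∈ Ioi (0 : ℝ), 0 ≤ f t) (hh : 0 < h) :
    (∫ x in Ioi 0, f x) - rightRiemannSumIoi f h ≤ ∫ x in (0 : ℝ)..h, f x := by
  rw [integral_Ioi_eq_intervalIntegral_add hint hh.le]
  linarith [integral_Ioi_le_rightRiemannSumIoi anti hint nonneg hh]

/-- (3.4.5), last inequality: `∫_0^h f ≤ h f(0)` for `f` decreasing.
[cite: DavisRabinowitz1984, Sect. 3.4 (3.4.5)] -/
theorem intervalIntegral_le_mul_apply_zero (anti : AntitoneOn f (Ici 0)) (hh : 0 ≤ h) :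
    ∫ x in (0 : ℝ)..h, f x ≤ h * f 0 := by
  have antih : AntitoneOn f (uIcc 0 h) := by
    rw [uIcc_of_le hh]
    exact anti.mono Icc_subset_Ici_self
  calc ∫ x in (0 : ℝ)..h, f x ≤ ∫ _ in (0 : ℝ)..h, f 0 :=
        intervalIntegral.integral_mono_on hh antih.intervalIntegrable intervalIntegrable_const fun x hx =>
          anti (mem_Ici.2 le_rfl) (mem_Ici.2 hx.1) hx.1
    _ = h * f 0 := by simp

/-- (3.4.5) combined: `0 ≤ ∫_0^∞ f - R_R(f; h) ≤ h f(0)`. [cite: DavisRabinowitz1984, Sect. 3.4 (3.4.5)] -/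
theorem integral_sub_rightRiemannSumIoi_mem_Icc (anti : AntitoneOn f (Ici 0)) (hint : IntegrableOn f (Ioi 0))
    (nonneg : ∀ t ∈ Ioi (0 : ℝ), 0 ≤ f t) (hh : 0 < h) :
    (∫ x in Ioi 0, f x) - rightRiemannSumIoi f h ∈ Icc 0 (h * f 0) :=
  ⟨integral_sub_rightRiemannSumIoi_nonneg anti hint nonneg hh,
    (integral_sub_rightRiemannSumIoi_le_integral anti hint nonneg hh).trans
      (intervalIntegral_le_mul_apply_zero anti hh.le)⟩

/-- The same for the left-hand sum: `-h f(0) ≤ ∫_0^∞ f - R_L(f; h) ≤ 0` (`R_L = h f(0) + R_R`).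
[cite: DavisRabinowitz1984, Sect. 3.4 (3.4.5)] -/
theorem integral_sub_leftRiemannSumIoi_mem_Icc (anti : AntitoneOn f (Ici 0)) (hint : IntegrableOn f (Ioi 0))
    (nonneg : ∀ t ∈ Ioi (0 : ℝ), 0 ≤ f t) (hh : 0 < h) :
    (∫ x in Ioi 0, f x) - leftRiemannSumIoi f h ∈ Icc (-(h * f 0)) 0 := by
  obtain ⟨h1, h2⟩ := integral_sub_rightRiemannSumIoi_mem_Icc anti hint nonneg hh
  unfold leftRiemannSumIoi
  constructor <;> linarith

/-- **Theorem (3.4.2)**: for `f` monotonic (here: non-negative and decreasing — the book's w.l.o.g. case) on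
`x ≥ 0` with `∫_0^∞ f` existing, `lim_{h → 0} R_R(f; h) = ∫_0^∞ f`.
[cite: DavisRabinowitz1984, Sect. 3.4 (3.4.2)] -/
theorem tendsto_rightRiemannSumIoi (anti : AntitoneOn f (Ici 0)) (hint : IntegrableOn f (Ioi 0))
    (nonneg : ∀ t ∈ Ioi (0 : ℝ), 0 ≤ f t) :
    Tendsto (rightRiemannSumIoi f) (𝓝[>] 0) (𝓝 (∫ x in Ioi 0, f x)) := by
  -- the error `e(h) = ∫ f - R_R(f; h) ∈ [0, h f(0)]` is squeezed to `0`
  have he : Tendsto (fun h => (∫ x in Ioi 0, f x) - rightRiemannSumIoi f h) (𝓝[>] 0) (𝓝 0) := by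
    have h0 : Tendsto (fun h : ℝ => h * f 0) (𝓝[>] 0) (𝓝 0) := by
      have : Tendsto (fun h : ℝ => h * f 0) (𝓝 0) (𝓝 (0 * f 0)) := tendsto_id.mul_const _
      rw [zero_mul] at this
      exact this.mono_left nhdsWithin_le_nhds
    refine tendsto_of_tendsto_of_tendsto_of_le_of_le' tendsto_const_nhds h0 ?_ ?_
    · filter_upwards [self_mem_nhdsWithin] with h hh
      exact integral_sub_rightRiemannSumIoi_nonneg anti hint nonneg hh
    · filter_upwards [self_mem_nhdsWithin] with h hh
      exact (integral_sub_rightRiemannSumIoi_mem_Icc anti hint nonneg hh).2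
  have := (tendsto_const_nhds (x := ∫ x in Ioi 0, f x)).sub he
  simpa using this

/-- (3.4.2) for the left-hand sum: `lim_{h → 0} R_L(f; h) = ∫_0^∞ f`.
[cite: DavisRabinowitz1984, Sect. 3.4 (3.4.2)] -/
theorem tendsto_leftRiemannSumIoi (anti : AntitoneOn f (Ici 0)) (hint : IntegrableOn f (Ioi 0))
    (nonneg : ∀ t ∈ Ioi (0 : ℝ), 0 ≤ f t) :
    Tendsto (leftRiemannSumIoi f) (𝓝[>] 0) (𝓝 (∫ x in Ioi 0, f x)) := by
  have h0 : Tendsto (fun h : ℝ => h * f 0) (𝓝[>] 0) (𝓝 0) := by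
    have : Tendsto (fun h : ℝ => h * f 0) (𝓝 0) (𝓝 (0 * f 0)) := tendsto_id.mul_const _
    rw [zero_mul] at this
    exact this.mono_left nhdsWithin_le_nhds
  have := h0.add (tendsto_rightRiemannSumIoi anti hint nonneg)
  rw [zero_add] at this
  exact this

/-- … and for the trapezoidal rule `T(f; h) = ½ h f(0) + R_R(f; h)`.
[cite: DavisRabinowitz1984, Sect. 3.4 (3.4.2)] -/
theorem tendsto_trapezoidalSumIoi (anti : AntitoneOn f (Ici 0)) (hint : IntegrableOn f (Ioi 0))
    (nonneg : ∀ t ∈ Ioi (0 : ℝ), 0 ≤ f t) :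
    Tendsto (trapezoidalSumIoi f) (𝓝[>] 0) (𝓝 (∫ x in Ioi 0, f x)) := by
  have h0 : Tendsto (fun h : ℝ => h / 2 * f 0) (𝓝[>] 0) (𝓝 0) := by
    have : Tendsto (fun h : ℝ => h / 2 * f 0) (𝓝 0) (𝓝 (0 / 2 * f 0)) :=
      (tendsto_id.div_const 2).mul_const _
    rw [zero_div, zero_mul] at this
    exact this.mono_left nhdsWithin_le_nhds
  have := h0.add (tendsto_rightRiemannSumIoi anti hint nonneg)
  rw [zero_add] at this
  exact this

end

end Literature.Analysis.Quadrature
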